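import Mathlib

/-!
# Siegel count from polynomial growth

Stub `stub_siegelCountFromGrowth` (S11) for the crux `HilbertIntegralOverconvergentIsCongruence`
(line Sketch-ideate-r1-k1): the elementary counting step feeding the line's algebraization engine
(Siegel's lemma).  Unknowns `card D ≥ 1` grow like `D ^ (d + 1)`
(`cβ D ^ (d + 1) ≤ card D ≤ cβ' D ^ (d + 1)` for `D ≥ 1`), conditions are counted by `Λ` with
`Λ 0 = 0` and `Λ n ≤ cΛ n ^ d` (`n ≥ 1`).  We produce thresholds `N₀ D` and a constant `Q` with
* `2 Λ (N₀ D) < card D` for every `D ≥ 1`;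
* for every `m`, some `D ≥ 1` with `m D ≤ N₀ D`;
* `card D ≤ Q ^ D` for every `D ≥ 1`.

Proof: `N₀ D` is the largest `n ≤ D * D` with `2 Λ n < card D` (`Nat.findGreatest`; `n = 0` is
admissible as `Λ 0 = 0 < 1 ≤ card D`).  Given `m`, any `D ≥ max m 1` with `2 cΛ m ^ d < cβ D` works:
`2 Λ (m D) ≤ 2 cΛ m ^ d D ^ d < cβ D ^ (d + 1) ≤ card D` and `m D ≤ D D`.  Finally
`card D ≤ cβ' D ^ (d + 1) ≤ max 1 cβ' (2 ^ D) ^ (d + 1) ≤ (max 1 cβ' * 2 ^ (d + 1)) ^ D`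
using `D ≤ 2 ^ D`.
-/

set_option linter.dupNamespace false

namespace Summit.Langlands.Langlands.Theorems.HilbertIntegralOverconvergentIsCongruence

/-- **Siegel count from polynomial growth.**
Unknowns `card D ≥ 1` growing like `c_β D^{d+1}` (`D ≥ 1`), conditions `Λ n ≤ c_Λ n^d` (`n ≥ 1`),
`Λ 0 = 0`, `Λ` monotone.  Then there are thresholds `N₀ D` (the largest `n ≤ D * D` with
`2 Λ n < card D`) satisfying the engine's `hcount` (`2 Λ (N₀ D) < card D` for `D ≥ 1`) and
`hgrowth` (`m D ≤ N₀ D` for some `D ≥ 1`, every `m`: take `D ≥ m` with `D > 2 c_Λ m^d / c_β`), and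
`card D ≤ Q^D` with `Q = max 1 c'_β · 2^{d+1}` (from `card D ≤ c'_β D^{d+1}` and
`D^{d+1} ≤ (2^D)^{d+1}`). [folklore] -/
theorem stub_siegelCountFromGrowth (d : ℕ) (_hd : 1 ≤ d) (card Λ : ℕ → ℕ) (hΛ0 : Λ 0 = 0)
    (_hΛmono : Monotone Λ)
    (cβ cβ' cΛ : ℝ) (hcβ : 0 < cβ) (_hcΛ : 0 < cΛ)
    (hcard1 : ∀ D, 1 ≤ D → 1 ≤ card D)
    (hcardlow : ∀ D : ℕ, 1 ≤ D → cβ * (D : ℝ) ^ (d + 1) ≤ (card D : ℝ))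
    (hcardup : ∀ D : ℕ, 1 ≤ D → (card D : ℝ) ≤ cβ' * (D : ℝ) ^ (d + 1))
    (hΛ : ∀ n : ℕ, 1 ≤ n → (Λ n : ℝ) ≤ cΛ * (n : ℝ) ^ d) :
    ∃ (N₀ : ℕ → ℕ) (Q : ℝ), (∀ D, 1 ≤ D → 2 * Λ (N₀ D) < card D) ∧
      (∀ m : ℕ, ∃ D : ℕ, 1 ≤ D ∧ m * D ≤ N₀ D) ∧ (∀ D : ℕ, 1 ≤ D → (card D : ℝ) ≤ Q ^ D) := by
  classical
  -- `n = 0` is always admissible (`D ≥ 1`)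
  have hP0 : ∀ D, 1 ≤ D → 2 * Λ 0 < card D := fun D hD => by
    rw [hΛ0, mul_zero]
    exact hcard1 D hD
  refine ⟨fun D => Nat.findGreatest (fun n => 2 * Λ n < card D) (D * D),
    max 1 cβ' * 2 ^ (d + 1), ?_, ?_, ?_⟩
  · -- (i) the threshold is admissible
    intro D hD
    exact Nat.findGreatest_spec (P := fun n => 2 * Λ n < card D) (Nat.zero_le _) (hP0 D hD)
  · -- (ii) the threshold at a suitable `D` exceeds `m D`
    intro m
    -- `D ≥ max m 1` with `2 cΛ m ^ d < cβ D`
    obtain ⟨D, hDdef⟩ : ∃ D : ℕ, D = m + ⌈2 * cΛ * (m : ℝ) ^ d / cβ⌉₊ + 1 := ⟨_, rfl⟩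
    have hD1 : 1 ≤ D := by omega
    have hmD : m ≤ D := by omega
    have hkey : 2 * cΛ * (m : ℝ) ^ d < cβ * D := by
      have h1 : 2 * cΛ * (m : ℝ) ^ d / cβ ≤ ⌈2 * cΛ * (m : ℝ) ^ d / cβ⌉₊ := Nat.le_ceil _
      have h2 : (⌈2 * cΛ * (m : ℝ) ^ d / cβ⌉₊ : ℝ) < D := by
        rw [hDdef]
        push_cast
        linarith
      have h3 : 2 * cΛ * (m : ℝ) ^ d / cβ < D := h1.trans_lt h2
      rw [div_lt_iff₀ hcβ] at h3
      linarith
    refine ⟨D, hD1, ?_⟩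
    rcases Nat.eq_zero_or_pos m with rfl | hm
    · simp
    · have hmD1 : 1 ≤ m * D := Nat.mul_pos hm hD1
      have hDpos : (0 : ℝ) < D := by exact_mod_cast hD1
      have hPmD : 2 * Λ (m * D) < card D := by
        have hreal : (2 * Λ (m * D) : ℝ) < card D := by
          calc (2 * Λ (m * D) : ℝ) ≤ 2 * (cΛ * ((m * D : ℕ) : ℝ) ^ d) := by
                have := hΛ (m * D) hmD1
                linarith
            _ = 2 * cΛ * (m : ℝ) ^ d * (D : ℝ) ^ d := by
                push_cast
                ring
            _ < cβ * D * (D : ℝ) ^ d := mul_lt_mul_of_pos_right hkey (pow_pos hDpos d)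
            _ = cβ * (D : ℝ) ^ (d + 1) := by ring
            _ ≤ card D := hcardlow D hD1
        exact_mod_cast hreal
      exact Nat.le_findGreatest (Nat.mul_le_mul_right D hmD) hPmD
  · -- (iii) exponential bound on the number of unknowns
    intro D hD
    have h2D : (D : ℝ) ≤ 2 ^ D := by exact_mod_cast (Nat.lt_two_pow_self).le
    have hM1 : 1 ≤ max 1 cβ' := le_max_left _ _
    calc (card D : ℝ) ≤ cβ' * (D : ℝ) ^ (d + 1) := hcardup D hD
      _ ≤ max 1 cβ' * (D : ℝ) ^ (d + 1) :=
          mul_le_mul_of_nonneg_right (le_max_right _ _) (by positivity)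
      _ ≤ max 1 cβ' * ((2 : ℝ) ^ D) ^ (d + 1) :=
          mul_le_mul_of_nonneg_left (pow_le_pow_left₀ (by positivity) h2D _) (by positivity)
      _ ≤ (max 1 cβ') ^ D * ((2 : ℝ) ^ D) ^ (d + 1) :=
          mul_le_mul_of_nonneg_right (le_self_pow₀ hM1 (by omega)) (by positivity)
      _ = (max 1 cβ' * 2 ^ (d + 1)) ^ D := by
          rw [mul_pow, ← pow_mul, ← pow_mul, mul_comm D (d + 1)]

end Summit.Langlands.Langlands.Theorems.HilbertIntegralOverconvergentIsCongruence
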